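import Mathlib
import HarnessLib
import Summits.Ventures.LatticeQCDFlow.Scaling.MetricTunnelling

/-!
# LatticeQCDFlow / Scaling — the metric small-step tunnelling laws for local paths of radii `(ρ, r)` (v3.1)

HONEST FRAMING: exact (Metropolis-corrected) sampling algorithms for lattice gauge theory; figures
of merit are autocorrelation/cost numbers at stated couplings and volumes; no continuum-physics
claim.

THEORY-2.md §3.3 (C2c-T) metric form.  `MetricTunnelling.lean` (tree) states the metric laws for
spaces in which EVERY pair `x, y` is joined by a path inside the closed `dist x y`-ball about `x`
(geodesic-type spaces: `Circle^E`, flat tori).  A compact matrix group in the Hilbert–Schmidt metric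
is reached only through a chart, which gives paths for CLOSE pairs and with a DISTORTION: pairs at
distance `≤ ρ` are joined inside the `r`-ball, `r = (1+ε)²ρ` (exponential chart of `SU(N)`, the tree's
`suChart_biLipschitz`) or `r = 2ρ` (Cayley chart of `U(N)`).  This additive file restates the
separating lemma and the laws for such LOCAL PATHS OF RADII `(ρ, r)` (hypothesis `hpath`; no
definition is introduced):

  `hpath : ∀ x y, dist x y ≤ ρ → ∃ γ, ContinuousOn γ (Icc 0 1) ∧ γ 0 = x ∧ γ 1 = y ∧ ∀ t ∈ Icc 0 1, dist (γ t) x ≤ r`.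

* `localPaths_of_forall` — the tree's all-pairs hypothesis gives `(ρ, ρ)`-local paths for every `ρ`;
* `mem_cthickening_of_ne_of_localPaths(_real)` — a `ρ`-small move changing a charge continuous off
  `D` (discrete-valued, resp. integer-valued real) starts in `cthickening r D`;
* `exists_localPath_pi_radii` — `(ρ, r)`-local paths pass to finite products in the sup metric;
* `compProd_ne_le_two_mul_cthickening_of_localPaths(_real)`, `…_add_of_localPaths_real`,
  `measure_ne_le_nsteps_cthickening_of_localPaths_real` — the laws with conclusion
  `2·μ(cthickening r D)` (one step, with exceptional set, `n` steps), from the tree's abstract laws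
  `compProd_chargeChange_le_of_invariant` / `_add_` / `measure_chargeChange_le_nsteps`.
The `SU(N)` and `U(N)` instances are `MetricTunnellingSUN.lean` / `MetricTunnellingUN.lean`.
No sorry, no new axioms, no `def`.
-/

noncomputable section

open MeasureTheory ProbabilityTheory Set Metric
open scoped ENNReal ProbabilityTheory

namespace Summit.Ventures.LatticeQCDFlow.Theory2.Tunnelling

/-! ## §1. The separating lemma for local paths of radii `(ρ, r)` -/

section Separating

variable {X : Type*} [PseudoMetricSpace X]

/-- Along a path from `x` to `y` that is continuous on `[0,1]` and stays in the closed `r`-ball about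
`x`, if `x` is not `r`-close to `D` the whole path avoids `D`: there is a preconnected set through `x`
and `y` inside `Dᶜ`. [folklore] -/
theorem exists_isPreconnected_subset_compl_of_path {D : Set X} {x y : X} {r : ℝ} {γ : ℝ → X}
    (hγc : ContinuousOn γ (Icc (0 : ℝ) 1)) (hγ0 : γ 0 = x) (hγ1 : γ 1 = y)
    (hγd : ∀ t ∈ Icc (0 : ℝ) 1, dist (γ t) x ≤ r) (hx : x ∉ cthickening r D) :
    ∃ s : Set X, IsPreconnected s ∧ x ∈ s ∧ y ∈ s ∧ s ⊆ Dᶜ := by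
  refine ⟨γ '' Icc (0 : ℝ) 1, isPreconnected_Icc.image γ hγc, ⟨0, left_mem_Icc.2 zero_le_one, hγ0⟩,
    ⟨1, right_mem_Icc.2 zero_le_one, hγ1⟩, ?_⟩
  rintro _ ⟨t, ht, rfl⟩ hD
  exact hx (mem_cthickening_of_dist_le x (γ t) r D hD (by rw [dist_comm]; exact hγd t ht))

/-- The all-pairs hypothesis of `MetricTunnelling.lean` (paths within `dist x y` of `x`) gives
`(ρ, ρ)`-local paths for every `ρ`. [folklore] -/
theorem localPaths_of_forall
    (h : ∀ x y : X, ∃ γ : ℝ → X, ContinuousOn γ (Icc (0 : ℝ) 1) ∧ γ 0 = x ∧ γ 1 = y ∧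
      ∀ t ∈ Icc (0 : ℝ) 1, dist (γ t) x ≤ dist x y) (ρ : ℝ) :
    ∀ x y : X, dist x y ≤ ρ → ∃ γ : ℝ → X, ContinuousOn γ (Icc (0 : ℝ) 1) ∧ γ 0 = x ∧ γ 1 = y ∧
      ∀ t ∈ Icc (0 : ℝ) 1, dist (γ t) x ≤ ρ := by
  intro x y hxy
  obtain ⟨γ, hγc, hγ0, hγ1, hγd⟩ := h x y
  exact ⟨γ, hγc, hγ0, hγ1, fun t ht => (hγd t ht).trans hxy⟩

/-- **Separating lemma (discrete charge, radii `(ρ, r)`).**  With `(ρ, r)`-local paths and `Q`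
continuous off `D` into a discrete space, a move of length `≤ ρ` that changes `Q` starts in the
closed `r`-thickening of `D`. [folklore] -/
theorem mem_cthickening_of_ne_of_localPaths {ι : Type*} [TopologicalSpace ι] [DiscreteTopology ι]
    {D : Set X} {Q : X → ι} (hQ : ContinuousOn Q Dᶜ) {ρ r : ℝ}
    (hpath : ∀ x y : X, dist x y ≤ ρ → ∃ γ : ℝ → X, ContinuousOn γ (Icc (0 : ℝ) 1) ∧ γ 0 = x ∧
      γ 1 = y ∧ ∀ t ∈ Icc (0 : ℝ) 1, dist (γ t) x ≤ r)
    {x y : X} (hxy : dist x y ≤ ρ) (hne : Q x ≠ Q y) : x ∈ cthickening r D := by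
  by_contra hx
  obtain ⟨γ, hγc, hγ0, hγ1, hγd⟩ := hpath x y hxy
  obtain ⟨s, hs, hxs, hys, hsD⟩ := exists_isPreconnected_subset_compl_of_path hγc hγ0 hγ1 hγd hx
  exact hne (hs.constant (hQ.mono hsD) hxs hys)

/-- **Separating lemma (integer-valued real charge, radii `(ρ, r)`).** [folklore] -/
theorem mem_cthickening_of_ne_of_localPaths_real {D : Set X} {Q : X → ℝ} (hQ : ContinuousOn Q Dᶜ)
    (hint : ∀ x, ∃ n : ℤ, Q x = n) {ρ r : ℝ}
    (hpath : ∀ x y : X, dist x y ≤ ρ → ∃ γ : ℝ → X, ContinuousOn γ (Icc (0 : ℝ) 1) ∧ γ 0 = x ∧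
      γ 1 = y ∧ ∀ t ∈ Icc (0 : ℝ) 1, dist (γ t) x ≤ r)
    {x y : X} (hxy : dist x y ≤ ρ) (hne : Q x ≠ Q y) : x ∈ cthickening r D := by
  by_contra hx
  obtain ⟨γ, hγc, hγ0, hγ1, hγd⟩ := hpath x y hxy
  obtain ⟨s, hs, hxs, hys, hsD⟩ := exists_isPreconnected_subset_compl_of_path hγc hγ0 hγ1 hγd hx
  exact hne (apply_eq_of_isPreconnected_of_forall_exists_int hs (hQ.mono hsD)
    (fun z _ => hint z) hxs hys)

/-- `(ρ, r)`-local paths pass to finite products in the sup metric (configuration spaces `E → G`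
from the paths of `G`, linkwise; `0 ≤ r`). [folklore] -/
theorem exists_localPath_pi_radii {E : Type*} [Fintype E] {Y : Type*} [PseudoMetricSpace Y]
    {ρ r : ℝ} (hr : 0 ≤ r)
    (h : ∀ a b : Y, dist a b ≤ ρ → ∃ γ : ℝ → Y, ContinuousOn γ (Icc (0 : ℝ) 1) ∧ γ 0 = a ∧ γ 1 = b ∧
      ∀ t ∈ Icc (0 : ℝ) 1, dist (γ t) a ≤ r)
    (x y : E → Y) (hxy : dist x y ≤ ρ) : ∃ γ : ℝ → (E → Y), ContinuousOn γ (Icc (0 : ℝ) 1) ∧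
      γ 0 = x ∧ γ 1 = y ∧ ∀ t ∈ Icc (0 : ℝ) 1, dist (γ t) x ≤ r := by
  have hc : ∀ e, dist (x e) (y e) ≤ ρ := fun e => (dist_le_pi_dist x y e).trans hxy
  choose γ hγc hγ0 hγ1 hγd using fun e => h (x e) (y e) (hc e)
  refine ⟨fun t e => γ e t, ?_, ?_, ?_, ?_⟩
  · exact continuousOn_pi.2 fun e => hγc e
  · funext e; exact hγ0 e
  · funext e; exact hγ1 e
  · intro t ht
    exact (dist_pi_le_iff hr).2 fun e => hγd e t ht

end Separating

/-! ## §2. The laws for local paths of radii `(ρ, r)` -/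

section Laws

variable {X : Type*} [PseudoMetricSpace X] [MeasurableSpace X]

/-- **Metric small-step tunnelling law (discrete charge, radii `(ρ, r)`).**  `Q` continuous off `D`
into a discrete space, `κ` a `μ`-invariant Markov kernel whose moves have length `≤ ρ` a.s.:
`(μ ⊗ₘ κ){Q ≠ Q'} ≤ 2·μ(cthickening r D)`. [folklore] -/
theorem compProd_ne_le_two_mul_cthickening_of_localPaths {ι : Type*} [TopologicalSpace ι]
    [DiscreteTopology ι] {D : Set X} {Q : X → ι} (hQ : ContinuousOn Q Dᶜ) {ρ r : ℝ}
    (hpath : ∀ x y : X, dist x y ≤ ρ → ∃ γ : ℝ → X, ContinuousOn γ (Icc (0 : ℝ) 1) ∧ γ 0 = x ∧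
      γ 1 = y ∧ ∀ t ∈ Icc (0 : ℝ) 1, dist (γ t) x ≤ r)
    (μ : Measure X) [SFinite μ] (κ : Kernel X X) [IsMarkovKernel κ] (hinv : κ.Invariant μ)
    (hstep : ∀ᵐ p ∂(μ ⊗ₘ κ), dist p.1 p.2 ≤ ρ) :
    (μ ⊗ₘ κ) {p | Q p.1 ≠ Q p.2} ≤ 2 * μ (cthickening r D) :=
  compProd_chargeChange_le_of_invariant (R := fun x y => dist x y ≤ ρ)
    (fun _ _ hxy hne => Or.inl (mem_cthickening_of_ne_of_localPaths hQ hpath hxy hne)) μ κ hinv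
    hstep

/-- **Metric small-step tunnelling law (integer-valued real charge, radii `(ρ, r)`).** [folklore] -/
theorem compProd_ne_le_two_mul_cthickening_of_localPaths_real {D : Set X} {Q : X → ℝ}
    (hQ : ContinuousOn Q Dᶜ) (hint : ∀ x, ∃ n : ℤ, Q x = n) {ρ r : ℝ}
    (hpath : ∀ x y : X, dist x y ≤ ρ → ∃ γ : ℝ → X, ContinuousOn γ (Icc (0 : ℝ) 1) ∧ γ 0 = x ∧
      γ 1 = y ∧ ∀ t ∈ Icc (0 : ℝ) 1, dist (γ t) x ≤ r)
    (μ : Measure X) [SFinite μ] (κ : Kernel X X) [IsMarkovKernel κ] (hinv : κ.Invariant μ)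
    (hstep : ∀ᵐ p ∂(μ ⊗ₘ κ), dist p.1 p.2 ≤ ρ) :
    (μ ⊗ₘ κ) {p | Q p.1 ≠ Q p.2} ≤ 2 * μ (cthickening r D) :=
  compProd_chargeChange_le_of_invariant (R := fun x y => dist x y ≤ ρ)
    (fun _ _ hxy hne => Or.inl (mem_cthickening_of_ne_of_localPaths_real hQ hint hpath hxy hne))
    μ κ hinv hstep

/-- **With an exceptional set** (no a.s. hypothesis on the step length; Gaussian-momentum moves):
`(μ ⊗ₘ κ){Q ≠ Q'} ≤ 2·μ(cthickening r D) + (μ ⊗ₘ κ){dist > ρ}`. [folklore] -/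
theorem compProd_ne_le_two_mul_cthickening_add_of_localPaths_real {D : Set X} {Q : X → ℝ}
    (hQ : ContinuousOn Q Dᶜ) (hint : ∀ x, ∃ n : ℤ, Q x = n) {ρ r : ℝ}
    (hpath : ∀ x y : X, dist x y ≤ ρ → ∃ γ : ℝ → X, ContinuousOn γ (Icc (0 : ℝ) 1) ∧ γ 0 = x ∧
      γ 1 = y ∧ ∀ t ∈ Icc (0 : ℝ) 1, dist (γ t) x ≤ r)
    (μ : Measure X) [SFinite μ] (κ : Kernel X X) [IsMarkovKernel κ] (hinv : κ.Invariant μ) :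
    (μ ⊗ₘ κ) {p | Q p.1 ≠ Q p.2} ≤
      2 * μ (cthickening r D) + (μ ⊗ₘ κ) {p | ¬ dist p.1 p.2 ≤ ρ} :=
  compProd_chargeChange_le_add_of_invariant (R := fun x y => dist x y ≤ ρ)
    (fun _ _ hxy hne => Or.inl (mem_cthickening_of_ne_of_localPaths_real hQ hint hpath hxy hne))
    μ κ hinv

/-- **`n`-step metric law (integer-valued real charge, radii `(ρ, r)`).**  Any process with all
marginals `m` and a.s. `ρ`-small consecutive steps keeps its charge for `n` steps except with
probability `≤ n·2·m(cthickening r D)`. [folklore] -/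
theorem measure_ne_le_nsteps_cthickening_of_localPaths_real {D : Set X} {Q : X → ℝ}
    (hQ : ContinuousOn Q Dᶜ) (hint : ∀ x, ∃ n : ℤ, Q x = n) {ρ r : ℝ}
    (hpath : ∀ x y : X, dist x y ≤ ρ → ∃ γ : ℝ → X, ContinuousOn γ (Icc (0 : ℝ) 1) ∧ γ 0 = x ∧
      γ 1 = y ∧ ∀ t ∈ Icc (0 : ℝ) 1, dist (γ t) x ≤ r)
    {Ω : Type*} [MeasurableSpace Ω] (P : Measure Ω) (Z : ℕ → Ω → X) (hZ : ∀ k, Measurable (Z k))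
    (m : Measure X) (hmarg : ∀ k, P.map (Z k) = m)
    (hstep : ∀ k, ∀ᵐ ω ∂P, dist (Z k ω) (Z (k + 1) ω) ≤ ρ) (n : ℕ) :
    P {ω | Q (Z n ω) ≠ Q (Z 0 ω)} ≤ n * (2 * m (cthickening r D)) := by
  refine measure_chargeChange_le_nsteps (R := fun _ x y => dist x y ≤ ρ)
    (B := fun _ => cthickening r D)
    (fun _ _ _ hxy hne => Or.inl (mem_cthickening_of_ne_of_localPaths_real hQ hint hpath hxy hne))
    P Z hstep (fun k => ?_) n
  have h1 : ∀ j, P (Z j ⁻¹' cthickening r D) ≤ m (cthickening r D) := fun j => by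
    rw [← hmarg j]; exact Measure.le_map_apply (hZ j).aemeasurable _
  calc P (Z k ⁻¹' cthickening r D) + P (Z (k + 1) ⁻¹' cthickening r D)
      ≤ m (cthickening r D) + m (cthickening r D) := add_le_add (h1 k) (h1 (k + 1))
    _ = 2 * m (cthickening r D) := (two_mul _).symm

end Laws

end Summit.Ventures.LatticeQCDFlow.Theory2.Tunnelling
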